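import Summits.CriticalPhenomena.PercolationContinuityZ3.Theorems.PinholeClosing.Negative.PinholeClosingResistance
import Literature.Probability.Percolation.DeletionTolerance

/-!
# `PinholeClosing` (crux r3 of route PercBudgetLadder, item stmt-CriticalPhenomena-5249): the trivial rung

Negative-side support file of the crux disprover (cdisprove seat), `sorry`-free, theorems only; continues
`PinholeClosingResistance.lean`.  The BASELINE every proof of the crux must improve on: by locality a
blocking set may be taken among the lattice edges inside the box (`exists_cutset_subset_edgesIn`), the last
closed edge is charged to finite energy (deletion tolerance `(1 - p_c) · P(ω \ {e} ∈ A) ≤ P(A)` for the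
measurable budget event `A`, `real_preimage_sdiff_singleton_le`), and a union bound over its position costs
`#edgesIn(box m)` (`blockedEv_succ_subset`, `blockProb_succ_le`:
`P(MinCut ≤ k+1) ≤ (1 + #edgesIn(box 3 m)/(1 - p_c)) · P(MinCut ≤ k)`).  Hence the crux HOLDS with the
NON-uniform constant `c'(n) = c (1 - p_c)/(1 - p_c + #edgesIn(box 3 (l n))) ≍ c · n⁻³`
(`pinholeClosing_baseline`); the content of r3 is exactly the removal of this entropy factor, i.e. uniformity
in `n`.  (Budget events are the min-cut events `{minOpenCutIn ≤ k}` of `MinOpenCut.lean`: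
`blockedEv_eq_setOf_minCut`, `measurableSet_blockedEv`.)
-/

namespace Summit.CriticalPhenomena.PercolationContinuityZ3.Theorems.PinholeClosing.Negative

open MeasureTheory Filter
open Literature.Probability.Percolation Literature.Probability.LatticeModels
open Summit.CriticalPhenomena.PercolationContinuityZ3.Theses

noncomputable section



/-- The blocked event is the min-cut event `{MinCut ≤ k}` of `MinOpenCut.lean`. [folklore] -/
theorem blockedEv_eq_setOf_minCut (k n m : ℕ) :
    ({ω : BondConfig (Site 3) | ∃ S : Finset (Sym2 (Site 3)), S.card ≤ k ∧ ¬ ∃ x ∈ box 3 (n), ∃ y ∈ innerBoundary (zdGraph 3) (box 3 (m)), (ω \ (↑S : Set (Sym2 (Site 3)))) ∈ openConnIn (↑(box 3 (m)) : Set (Site 3)) x y}) = {ω | minOpenCutIn (↑(box 3 m) : Set (Site 3)) ↑(box 3 n)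
      ↑(innerBoundary (zdGraph 3) (box 3 m)) ω ≤ k} := by
  ext ω
  simp only [Set.mem_setOf_eq, minOpenCutIn_le_iff, Finset.mem_coe]

/-- The budget events are measurable (cylinder events of the finite box). [folklore] -/
theorem measurableSet_blockedEv (k n m : ℕ) : MeasurableSet (({ω : BondConfig (Site 3) | ∃ S : Finset (Sym2 (Site 3)), S.card ≤ k ∧ ¬ ∃ x ∈ box 3 (n), ∃ y ∈ innerBoundary (zdGraph 3) (box 3 (m)), (ω \ (↑S : Set (Sym2 (Site 3)))) ∈ openConnIn (↑(box 3 (m)) : Set (Site 3)) x y})) := by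
  rw [blockedEv_eq_setOf_minCut]
  exact measurableSet_setOf_minOpenCutIn_le (Finset.finite_toSet _) _ _ k

/-- Restricting a closed set to the lattice edges inside the box does not change the configuration seen
inside the box (lattice configurations). [folklore] -/
theorem sdiff_filter_edgesIn_eq {m : ℕ} {ω : BondConfig (Site 3)} (hω : ω ⊆ (zdGraph 3).edgeSet)
    (S : Finset (Sym2 (Site 3))) :
    ω \ ↑(S.filter fun e => e ∈ edgesIn (zdGraph 3) (box 3 m)) =
      ω \ (↑S ∩ (↑(box 3 m) : Set (Site 3)).sym2) := by
  ext e
  induction e using Sym2.ind with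
  | h a b =>
    simp only [Set.mem_sdiff, Finset.coe_filter, Set.mem_setOf_eq, mem_edgesIn_iff, Set.mem_inter_iff,
      Finset.mem_coe, Set.mk_mem_sym2_iff, Sym2.mem_iff, forall_eq_or_imp, forall_eq]
    constructor
    · rintro ⟨heω, hne⟩
      exact ⟨heω, fun ⟨heS, ha, hb⟩ => hne ⟨heS, hω heω, ha, hb⟩⟩
    · rintro ⟨heω, hne⟩
      exact ⟨heω, fun ⟨heS, _, ha, hb⟩ => hne ⟨heS, ha, hb⟩⟩

/-- **Normal form of a blocking set** (lattice configurations): it may be taken among the lattice edges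
inside `box 3 m`. [folklore] -/
theorem exists_cutset_subset_edgesIn {k n m : ℕ} {ω : BondConfig (Site 3)}
    (hω : ω ⊆ (zdGraph 3).edgeSet) (h : ω ∈ ({ω : BondConfig (Site 3) | ∃ S : Finset (Sym2 (Site 3)), S.card ≤ k ∧ ¬ ∃ x ∈ box 3 (n), ∃ y ∈ innerBoundary (zdGraph 3) (box 3 (m)), (ω \ (↑S : Set (Sym2 (Site 3)))) ∈ openConnIn (↑(box 3 (m)) : Set (Site 3)) x y})) :
    ∃ S : Finset (Sym2 (Site 3)), S ⊆ edgesIn (zdGraph 3) (box 3 m) ∧ S.card ≤ k ∧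
      ¬ ∃ x ∈ box 3 n, ∃ y ∈ innerBoundary (zdGraph 3) (box 3 m),
        (ω \ ↑S) ∈ openConnIn ↑(box 3 m) x y := by
  obtain ⟨S, hS, hb⟩ := h
  refine ⟨S.filter fun e => e ∈ edgesIn (zdGraph 3) (box 3 m), fun e he => (Finset.mem_filter.1 he).2,
    (Finset.card_filter_le _ _).trans hS, ?_⟩
  rw [sdiff_filter_edgesIn_eq hω]
  have hb' : IsOpenCutsetIn (↑(box 3 m) : Set (Site 3)) ↑(box 3 n) ↑(innerBoundary (zdGraph 3) (box 3 m))
      ω ↑S := fun x hx y hy hxy => hb ⟨x, hx, y, hy, hxy⟩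
  have hb'' := isOpenCutsetIn_inter_sym2_iff.2 hb'
  rintro ⟨x, hx, y, hy, hxy⟩
  exact hb'' x hx y hy hxy

/-- **Union-bound decomposition** (lattice configurations): budget `k+1` = budget `k`, or budget `k` after
closing ONE lattice edge inside the box. [folklore] -/
theorem blockedEv_succ_subset {k n m : ℕ} {ω : BondConfig (Site 3)} (hω : ω ⊆ (zdGraph 3).edgeSet)
    (h : ω ∈ ({ω : BondConfig (Site 3) | ∃ S : Finset (Sym2 (Site 3)), S.card ≤ k + 1 ∧ ¬ ∃ x ∈ box 3 (n), ∃ y ∈ innerBoundary (zdGraph 3) (box 3 (m)), (ω \ (↑S : Set (Sym2 (Site 3)))) ∈ openConnIn (↑(box 3 (m)) : Set (Site 3)) x y})) :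
    ω ∈ ({ω : BondConfig (Site 3) | ∃ S : Finset (Sym2 (Site 3)), S.card ≤ k ∧ ¬ ∃ x ∈ box 3 (n), ∃ y ∈ innerBoundary (zdGraph 3) (box 3 (m)), (ω \ (↑S : Set (Sym2 (Site 3)))) ∈ openConnIn (↑(box 3 (m)) : Set (Site 3)) x y}) ∪ ⋃ e ∈ edgesIn (zdGraph 3) (box 3 m),
      (fun ω' : BondConfig (Site 3) => ω' \ {e}) ⁻¹' ({ω : BondConfig (Site 3) | ∃ S : Finset (Sym2 (Site 3)), S.card ≤ k ∧ ¬ ∃ x ∈ box 3 (n), ∃ y ∈ innerBoundary (zdGraph 3) (box 3 (m)), (ω \ (↑S : Set (Sym2 (Site 3)))) ∈ openConnIn (↑(box 3 (m)) : Set (Site 3)) x y}) := by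
  obtain ⟨S, hSE, hS, hb⟩ := exists_cutset_subset_edgesIn hω h
  by_cases hk : S.card ≤ k
  · exact Or.inl ⟨S, hk, hb⟩
  · have hpos : 0 < S.card := by omega
    obtain ⟨e, he⟩ := Finset.card_pos.1 hpos
    refine Or.inr (Set.mem_biUnion (hSE he) ?_)
    refine ⟨S.erase e, ?_, ?_⟩
    · rw [Finset.card_erase_of_mem he]; omega
    · have hset : (ω \ {e}) \ ↑(S.erase e) = ω \ ↑S := by
        ext f
        by_cases hfe : f = e
        · subst hfe
          simp [he]
        · simp [hfe]
      show ¬ ∃ x ∈ box 3 n, ∃ y ∈ innerBoundary (zdGraph 3) (box 3 m),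
        ((ω \ {e}) \ ↑(S.erase e)) ∈ openConnIn ↑(box 3 m) x y
      rw [hset]
      exact hb

/-- **Deletion tolerance for the budget event**: `(1 - p_c) · P(ω \ {e} ∈ bEv k) ≤ P(bEv k)`. [folklore] -/
theorem real_preimage_sdiff_singleton_le (k n m : ℕ) (e : Sym2 (Site 3)) :
    (1 - (criticalProbI 3 : ℝ)) * (bondPercolation (zdGraph 3) (criticalProbI 3)).real ((fun ω : BondConfig (Site 3) => ω \ {e}) ⁻¹' ({ω : BondConfig (Site 3) | ∃ S : Finset (Sym2 (Site 3)), S.card ≤ k ∧ ¬ ∃ x ∈ box 3 (n), ∃ y ∈ innerBoundary (zdGraph 3) (box 3 (m)), (ω \ (↑S : Set (Sym2 (Site 3)))) ∈ openConnIn (↑(box 3 (m)) : Set (Site 3)) x y}))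
      ≤ ((bondPercolation (zdGraph 3) (criticalProbI 3)).real {ω : BondConfig (Site 3) | ∃ S : Finset (Sym2 (Site 3)), S.card ≤ k ∧ ¬ ∃ x ∈ box 3 (n), ∃ y ∈ innerBoundary (zdGraph 3) (box 3 (m)), (ω \ (↑S : Set (Sym2 (Site 3)))) ∈ openConnIn (↑(box 3 (m)) : Set (Site 3)) x y}) := by
  have h := bondPercolation_pow_mul_real_preimage_closeEdges_le (zdGraph 3) (criticalProbI 3) {e}
    (measurableSet_blockedEv k n m)
  simpa [closeEdges_eq] using h

/-- **One rung costs a factor `1 + #edgesIn(box m)/(1 - p_c)`**: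
`P(MinCut ≤ k+1) ≤ (1 + #edgesIn(box 3 m) / (1 - p_c)) · P(MinCut ≤ k)`. [folklore] -/
theorem blockProb_succ_le (k n m : ℕ) :
    ((bondPercolation (zdGraph 3) (criticalProbI 3)).real {ω : BondConfig (Site 3) | ∃ S : Finset (Sym2 (Site 3)), S.card ≤ k + 1 ∧ ¬ ∃ x ∈ box 3 (n), ∃ y ∈ innerBoundary (zdGraph 3) (box 3 (m)), (ω \ (↑S : Set (Sym2 (Site 3)))) ∈ openConnIn (↑(box 3 (m)) : Set (Site 3)) x y}) ≤
      (1 + ((edgesIn (zdGraph 3) (box 3 m)).card : ℝ) / (1 - (criticalProbI 3 : ℝ))) * ((bondPercolation (zdGraph 3) (criticalProbI 3)).real {ω : BondConfig (Site 3) | ∃ S : Finset (Sym2 (Site 3)), S.card ≤ k ∧ ¬ ∃ x ∈ box 3 (n), ∃ y ∈ innerBoundary (zdGraph 3) (box 3 (m)), (ω \ (↑S : Set (Sym2 (Site 3)))) ∈ openConnIn (↑(box 3 (m)) : Set (Site 3)) x y}) := by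
  have hq : 0 < 1 - (criticalProbI 3 : ℝ) := sub_pos.2 pc_lt_one
  set T := edgesIn (zdGraph 3) (box 3 m) with hT
  set pre : Sym2 (Site 3) → Set (BondConfig (Site 3)) :=
    fun e => (fun ω : BondConfig (Site 3) => ω \ {e}) ⁻¹' ({ω : BondConfig (Site 3) | ∃ S : Finset (Sym2 (Site 3)), S.card ≤ k ∧ ¬ ∃ x ∈ box 3 (n), ∃ y ∈ innerBoundary (zdGraph 3) (box 3 (m)), (ω \ (↑S : Set (Sym2 (Site 3)))) ∈ openConnIn (↑(box 3 (m)) : Set (Site 3)) x y}) with hpre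
  have h1 : ((bondPercolation (zdGraph 3) (criticalProbI 3)).real {ω : BondConfig (Site 3) | ∃ S : Finset (Sym2 (Site 3)), S.card ≤ k + 1 ∧ ¬ ∃ x ∈ box 3 (n), ∃ y ∈ innerBoundary (zdGraph 3) (box 3 (m)), (ω \ (↑S : Set (Sym2 (Site 3)))) ∈ openConnIn (↑(box 3 (m)) : Set (Site 3)) x y}) ≤ (bondPercolation (zdGraph 3) (criticalProbI 3)).real (({ω : BondConfig (Site 3) | ∃ S : Finset (Sym2 (Site 3)), S.card ≤ k ∧ ¬ ∃ x ∈ box 3 (n), ∃ y ∈ innerBoundary (zdGraph 3) (box 3 (m)), (ω \ (↑S : Set (Sym2 (Site 3)))) ∈ openConnIn (↑(box 3 (m)) : Set (Site 3)) x y}) ∪ ⋃ e ∈ T, pre e) :=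
    real_mono_of_lattice fun ω hω h => blockedEv_succ_subset hω h
  have h2 : (bondPercolation (zdGraph 3) (criticalProbI 3)).real (({ω : BondConfig (Site 3) | ∃ S : Finset (Sym2 (Site 3)), S.card ≤ k ∧ ¬ ∃ x ∈ box 3 (n), ∃ y ∈ innerBoundary (zdGraph 3) (box 3 (m)), (ω \ (↑S : Set (Sym2 (Site 3)))) ∈ openConnIn (↑(box 3 (m)) : Set (Site 3)) x y}) ∪ ⋃ e ∈ T, pre e) ≤ ((bondPercolation (zdGraph 3) (criticalProbI 3)).real {ω : BondConfig (Site 3) | ∃ S : Finset (Sym2 (Site 3)), S.card ≤ k ∧ ¬ ∃ x ∈ box 3 (n), ∃ y ∈ innerBoundary (zdGraph 3) (box 3 (m)), (ω \ (↑S : Set (Sym2 (Site 3)))) ∈ openConnIn (↑(box 3 (m)) : Set (Site 3)) x y}) + ∑ e ∈ T, (bondPercolation (zdGraph 3) (criticalProbI 3)).real (pre e) :=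
    (measureReal_union_le _ _).trans (by
      gcongr
      exact measureReal_biUnion_finset_le _ _)
  have h3 : ∀ e ∈ T, (bondPercolation (zdGraph 3) (criticalProbI 3)).real (pre e) ≤ ((bondPercolation (zdGraph 3) (criticalProbI 3)).real {ω : BondConfig (Site 3) | ∃ S : Finset (Sym2 (Site 3)), S.card ≤ k ∧ ¬ ∃ x ∈ box 3 (n), ∃ y ∈ innerBoundary (zdGraph 3) (box 3 (m)), (ω \ (↑S : Set (Sym2 (Site 3)))) ∈ openConnIn (↑(box 3 (m)) : Set (Site 3)) x y}) / (1 - (criticalProbI 3 : ℝ)) := by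
    intro e _
    rw [le_div_iff₀ hq, mul_comm]
    exact real_preimage_sdiff_singleton_le k n m e
  calc ((bondPercolation (zdGraph 3) (criticalProbI 3)).real {ω : BondConfig (Site 3) | ∃ S : Finset (Sym2 (Site 3)), S.card ≤ k + 1 ∧ ¬ ∃ x ∈ box 3 (n), ∃ y ∈ innerBoundary (zdGraph 3) (box 3 (m)), (ω \ (↑S : Set (Sym2 (Site 3)))) ∈ openConnIn (↑(box 3 (m)) : Set (Site 3)) x y}) ≤ ((bondPercolation (zdGraph 3) (criticalProbI 3)).real {ω : BondConfig (Site 3) | ∃ S : Finset (Sym2 (Site 3)), S.card ≤ k ∧ ¬ ∃ x ∈ box 3 (n), ∃ y ∈ innerBoundary (zdGraph 3) (box 3 (m)), (ω \ (↑S : Set (Sym2 (Site 3)))) ∈ openConnIn (↑(box 3 (m)) : Set (Site 3)) x y}) + ∑ e ∈ T, (bondPercolation (zdGraph 3) (criticalProbI 3)).real (pre e) := h1.trans h2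
    _ ≤ ((bondPercolation (zdGraph 3) (criticalProbI 3)).real {ω : BondConfig (Site 3) | ∃ S : Finset (Sym2 (Site 3)), S.card ≤ k ∧ ¬ ∃ x ∈ box 3 (n), ∃ y ∈ innerBoundary (zdGraph 3) (box 3 (m)), (ω \ (↑S : Set (Sym2 (Site 3)))) ∈ openConnIn (↑(box 3 (m)) : Set (Site 3)) x y}) + ∑ _e ∈ T, ((bondPercolation (zdGraph 3) (criticalProbI 3)).real {ω : BondConfig (Site 3) | ∃ S : Finset (Sym2 (Site 3)), S.card ≤ k ∧ ¬ ∃ x ∈ box 3 (n), ∃ y ∈ innerBoundary (zdGraph 3) (box 3 (m)), (ω \ (↑S : Set (Sym2 (Site 3)))) ∈ openConnIn (↑(box 3 (m)) : Set (Site 3)) x y}) / (1 - (criticalProbI 3 : ℝ)) := by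
        gcongr with e he; exact h3 e he
    _ = (1 + (T.card : ℝ) / (1 - (criticalProbI 3 : ℝ))) * ((bondPercolation (zdGraph 3) (criticalProbI 3)).real {ω : BondConfig (Site 3) | ∃ S : Finset (Sym2 (Site 3)), S.card ≤ k ∧ ¬ ∃ x ∈ box 3 (n), ∃ y ∈ innerBoundary (zdGraph 3) (box 3 (m)), (ω \ (↑S : Set (Sym2 (Site 3)))) ∈ openConnIn (↑(box 3 (m)) : Set (Site 3)) x y}) := by
        rw [Finset.sum_const, nsmul_eq_mul]; ring

/-- **The baseline (non-uniform pinhole closing).**  For every k, l ≥ 1, n: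
`P(MinCut(n, 2ln) ≤ k) ≥ (1 - p_c)/(1 - p_c + #edgesIn(box 3 (l n))) · P(MinCut(n, l n) ≤ k+1)` — the crux
with `c'(n) ≍ c · n⁻³` instead of a uniform `c'`. [folklore] -/
theorem pinholeClosing_baseline (k l n : ℕ) (hl : 1 ≤ l) :
    (1 - (criticalProbI 3 : ℝ)) / (1 - (criticalProbI 3 : ℝ) + (edgesIn (zdGraph 3) (box 3 (l * n))).card) *
        ((bondPercolation (zdGraph 3) (criticalProbI 3)).real {ω : BondConfig (Site 3) | ∃ S : Finset (Sym2 (Site 3)), S.card ≤ k + 1 ∧ ¬ ∃ x ∈ box 3 (n), ∃ y ∈ innerBoundary (zdGraph 3) (box 3 (l * n)), (ω \ (↑S : Set (Sym2 (Site 3)))) ∈ openConnIn (↑(box 3 (l * n)) : Set (Site 3)) x y}) ≤ ((bondPercolation (zdGraph 3) (criticalProbI 3)).real {ω : BondConfig (Site 3) | ∃ S : Finset (Sym2 (Site 3)), S.card ≤ k ∧ ¬ ∃ x ∈ box 3 (n), ∃ y ∈ innerBoundary (zdGraph 3) (box 3 (2 * l * n)), (ω \ (↑S : Set (Sym2 (Site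 3)))) ∈ openConnIn (↑(box 3 (2 * l * n)) : Set (Site 3)) x y}) := by
  have hq : 0 < 1 - (criticalProbI 3 : ℝ) := sub_pos.2 pc_lt_one
  set E : ℝ := ((edgesIn (zdGraph 3) (box 3 (l * n))).card : ℝ) with hE
  have hE0 : 0 ≤ E := by positivity
  have h1 := blockProb_succ_le k n (l * n)
  have h2 : ((bondPercolation (zdGraph 3) (criticalProbI 3)).real {ω : BondConfig (Site 3) | ∃ S : Finset (Sym2 (Site 3)), S.card ≤ k ∧ ¬ ∃ x ∈ box 3 (n), ∃ y ∈ innerBoundary (zdGraph 3) (box 3 (l * n)), (ω \ (↑S : Set (Sym2 (Site 3)))) ∈ openConnIn (↑(box 3 (l * n)) : Set (Site 3)) x y}) ≤ ((bondPercolation (zdGraph 3) (criticalProbI 3)).real {ω : BondConfig (Site 3) | ∃ S : Finset (Sym2 (Site 3)), S.card ≤ k ∧ ¬ ∃ x ∈ box 3 (n), ∃ y ∈ innerBoundary (zdGraph 3) (box 3 (2 * l * n)), (ω \ (↑S : Set (Sym2 (Site 3)))) ∈ openConnIn (↑(box 3 (2 * l * n)) : Set (Site 3)) x y}) :=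
    blockProb_mono_aspect (by nlinarith) (by nlinarith)
  have hden : 0 < 1 - (criticalProbI 3 : ℝ) + E := by linarith
  rw [div_mul_eq_mul_div, div_le_iff₀ hden]
  have h1' : ((bondPercolation (zdGraph 3) (criticalProbI 3)).real {ω : BondConfig (Site 3) | ∃ S : Finset (Sym2 (Site 3)), S.card ≤ k + 1 ∧ ¬ ∃ x ∈ box 3 (n), ∃ y ∈ innerBoundary (zdGraph 3) (box 3 (l * n)), (ω \ (↑S : Set (Sym2 (Site 3)))) ∈ openConnIn (↑(box 3 (l * n)) : Set (Site 3)) x y}) * (1 - (criticalProbI 3 : ℝ)) ≤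
      (1 - (criticalProbI 3 : ℝ) + E) * ((bondPercolation (zdGraph 3) (criticalProbI 3)).real {ω : BondConfig (Site 3) | ∃ S : Finset (Sym2 (Site 3)), S.card ≤ k ∧ ¬ ∃ x ∈ box 3 (n), ∃ y ∈ innerBoundary (zdGraph 3) (box 3 (l * n)), (ω \ (↑S : Set (Sym2 (Site 3)))) ∈ openConnIn (↑(box 3 (l * n)) : Set (Site 3)) x y}) := by
    have := mul_le_mul_of_nonneg_right h1 hq.le
    calc ((bondPercolation (zdGraph 3) (criticalProbI 3)).real {ω : BondConfig (Site 3) | ∃ S : Finset (Sym2 (Site 3)), S.card ≤ k + 1 ∧ ¬ ∃ x ∈ box 3 (n), ∃ y ∈ innerBoundary (zdGraph 3) (box 3 (l * n)), (ω \ (↑S : Set (Sym2 (Site 3)))) ∈ openConnIn (↑(box 3 (l * n)) : Set (Site 3)) x y}) * (1 - (criticalProbI 3 : ℝ))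
        ≤ (1 + E / (1 - (criticalProbI 3 : ℝ))) * ((bondPercolation (zdGraph 3) (criticalProbI 3)).real {ω : BondConfig (Site 3) | ∃ S : Finset (Sym2 (Site 3)), S.card ≤ k ∧ ¬ ∃ x ∈ box 3 (n), ∃ y ∈ innerBoundary (zdGraph 3) (box 3 (l * n)), (ω \ (↑S : Set (Sym2 (Site 3)))) ∈ openConnIn (↑(box 3 (l * n)) : Set (Site 3)) x y}) * (1 - (criticalProbI 3 : ℝ)) := this
      _ = (1 - (criticalProbI 3 : ℝ) + E) * ((bondPercolation (zdGraph 3) (criticalProbI 3)).real {ω : BondConfig (Site 3) | ∃ S : Finset (Sym2 (Site 3)), S.card ≤ k ∧ ¬ ∃ x ∈ box 3 (n), ∃ y ∈ innerBoundary (zdGraph 3) (box 3 (l * n)), (ω \ (↑S : Set (Sym2 (Site 3)))) ∈ openConnIn (↑(box 3 (l * n)) : Set (Site 3)) x y}) := by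
          field_simp
  calc (1 - (criticalProbI 3 : ℝ)) * ((bondPercolation (zdGraph 3) (criticalProbI 3)).real {ω : BondConfig (Site 3) | ∃ S : Finset (Sym2 (Site 3)), S.card ≤ k + 1 ∧ ¬ ∃ x ∈ box 3 (n), ∃ y ∈ innerBoundary (zdGraph 3) (box 3 (l * n)), (ω \ (↑S : Set (Sym2 (Site 3)))) ∈ openConnIn (↑(box 3 (l * n)) : Set (Site 3)) x y})
      = ((bondPercolation (zdGraph 3) (criticalProbI 3)).real {ω : BondConfig (Site 3) | ∃ S : Finset (Sym2 (Site 3)), S.card ≤ k + 1 ∧ ¬ ∃ x ∈ box 3 (n), ∃ y ∈ innerBoundary (zdGraph 3) (box 3 (l * n)), (ω \ (↑S : Set (Sym2 (Site 3)))) ∈ openConnIn (↑(box 3 (l * n)) : Set (Site 3)) x y}) * (1 - (criticalProbI 3 : ℝ)) := by ring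
    _ ≤ (1 - (criticalProbI 3 : ℝ) + E) * ((bondPercolation (zdGraph 3) (criticalProbI 3)).real {ω : BondConfig (Site 3) | ∃ S : Finset (Sym2 (Site 3)), S.card ≤ k ∧ ¬ ∃ x ∈ box 3 (n), ∃ y ∈ innerBoundary (zdGraph 3) (box 3 (l * n)), (ω \ (↑S : Set (Sym2 (Site 3)))) ∈ openConnIn (↑(box 3 (l * n)) : Set (Site 3)) x y}) := h1'
    _ ≤ (1 - (criticalProbI 3 : ℝ) + E) * ((bondPercolation (zdGraph 3) (criticalProbI 3)).real {ω : BondConfig (Site 3) | ∃ S : Finset (Sym2 (Site 3)), S.card ≤ k ∧ ¬ ∃ x ∈ box 3 (n), ∃ y ∈ innerBoundary (zdGraph 3) (box 3 (2 * l * n)), (ω \ (↑S : Set (Sym2 (Site 3)))) ∈ openConnIn (↑(box 3 (2 * l * n)) : Set (Site 3)) x y}) := by gcongr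
    _ = ((bondPercolation (zdGraph 3) (criticalProbI 3)).real {ω : BondConfig (Site 3) | ∃ S : Finset (Sym2 (Site 3)), S.card ≤ k ∧ ¬ ∃ x ∈ box 3 (n), ∃ y ∈ innerBoundary (zdGraph 3) (box 3 (2 * l * n)), (ω \ (↑S : Set (Sym2 (Site 3)))) ∈ openConnIn (↑(box 3 (2 * l * n)) : Set (Site 3)) x y}) * (1 - (criticalProbI 3 : ℝ) + E) := by ring


end

end Summit.CriticalPhenomena.PercolationContinuityZ3.Theorems.PinholeClosing.Negative
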